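import Mathlib
import Summits.KontsevichZagierPeriods.Zeta5Search.Families.GapGaugeMove
import HarnessLib

/-!
# ζ(5) search — Families: the dual gap constant term of a balanced cyclic configuration is GAUGE-INDEPENDENT

HONEST FRAMING: systematic search; no irrationality claim unless certified.  Cell `pub-zeta5`, seat P2 g10 (Families
layer), 2026-08-23.  An identity between coefficients of integer polynomials; nothing about any zeta value; no record
moves; no conjecture node is used.

A CYCLIC CONFIGURATION on `N = M + 3` points `ℤ/N` (the dual seating of a cellular integrand): symmetric chord
multiplicities `A x y` and side multiplicities `B x` on the sides `{x, x+1}` (`x, y : Fin N`), BALANCED: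
`Σ_{y ≠ x} A x y = B (x−1) + B x` at every point.  The GAUGE `r` puts the point `r` at infinity; the finite points
`r+1, r+2, …, r+N−1` span the gaps `t = 0, …, M` (gap `t` = side `{r+1+t, r+2+t}`), and the dual gap constant term in
gauge `r` is `[∏_t g_t^{B(r+1+t)}] endProd M (A (r+1+·) (r+1+·))` (labels reduced mod `N` by `Fin.ofNat`; written out,
no new definition).  **`GapRegime.gaugeCT_succ`** (= the adjacent move `GapRegime.gauge_move` of `Families/GapGaugeMove`,
relabelled) and **`GapRegime.gaugeCT_eq_gauge_zero`**: the value does not depend on `r`.  Standard axioms only.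
-/

namespace Summit.KontsevichZagierPeriods.Zeta5Search.Families.Cellular

namespace GapRegime

open MvPolynomial Finset

variable {M : ℕ}

/-- Congruence of `endProd` in the chord multiplicities (all pairs). -/
theorem endProd_congr_all {A₁ A₂ : ℕ → ℕ → ℕ} (h : ∀ i j, A₁ i j = A₂ i j) : endProd M A₁ = endProd M A₂ := by
  unfold endProd
  exact Finset.prod_congr rfl fun i _ => Finset.prod_congr rfl fun j _ => by rw [h i j]

/-- `Fin.ofNat` is additive. -/
theorem ofNat_add' (n a b : ℕ) [NeZero n] : Fin.ofNat n (a + b) = Fin.ofNat n a + Fin.ofNat n b := by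
  ext; simp [Fin.val_add, Nat.add_mod]

/-- `Fin.ofNat` of the value of an element is the element. -/
theorem ofNat_val' (n : ℕ) [NeZero n] (v : Fin n) : Fin.ofNat n v.val = v := by
  ext; simp

/-- Rotating a sum over `Fin n`. -/
theorem sum_fin_rotate {n : ℕ} [NeZero n] (f : Fin n → ℕ) (c : Fin n) : (∑ v : Fin n, f (c + v)) = ∑ y : Fin n, f y :=
  Fintype.sum_equiv (Equiv.addLeft c) _ _ fun _ => rfl

/-- **One step around the circle**: the gap constant term with the point `r+1` at infinity equals the one with the point
`r` at infinity (the adjacent move `GapRegime.gauge_move` for the labelling `u ↦ r+1+u`). -/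
theorem gaugeCT_succ (A : Fin (M + 3) → Fin (M + 3) → ℕ) (B : Fin (M + 3) → ℕ) (hA : ∀ x y, A x y = A y x)
    (hbal : ∀ x : Fin (M + 3), (∑ y : Fin (M + 3), if y = x then 0 else A x y) = B (x - 1) + B x) (r : ℕ) :
    coeff (gapVec M fun t => B (Fin.ofNat (M + 3) (r + 2 + t)))
        (endProd M fun i j => A (Fin.ofNat (M + 3) (r + 2 + i)) (Fin.ofNat (M + 3) (r + 2 + j))) =
      coeff (gapVec M fun t => B (Fin.ofNat (M + 3) (r + 1 + t)))
        (endProd M fun i j => A (Fin.ofNat (M + 3) (r + 1 + i)) (Fin.ofNat (M + 3) (r + 1 + j))) := by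
  have key := gauge_move (M := M) (fun u v => A (Fin.ofNat (M + 3) (r + 1 + u)) (Fin.ofNat (M + 3) (r + 1 + v)))
    (fun u => B (Fin.ofNat (M + 3) (r + 1 + u))) ?_
  · -- reindex `r + 1 + (t + 1) = r + 2 + t`
    have hg : (gapVec M fun t => B (Fin.ofNat (M + 3) (r + 1 + (t + 1)))) =
        gapVec M fun t => B (Fin.ofNat (M + 3) (r + 2 + t)) := by
      ext t; simp only [gapVec, Finsupp.coe_equivFunOnFinite_symm]; congr 2; ring
    have he : (endProd M fun i j => A (Fin.ofNat (M + 3) (r + 1 + (i + 1))) (Fin.ofNat (M + 3) (r + 1 + (j + 1)))) =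
        endProd M fun i j => A (Fin.ofNat (M + 3) (r + 2 + i)) (Fin.ofNat (M + 3) (r + 2 + j)) :=
      endProd_congr_all fun i j => by congr 2 <;> ring
    rw [hg, he] at key
    exact key
  · -- the balance at the label `x = r + 1 + u`
    intro u hu1 hu2
    set c : Fin (M + 3) := Fin.ofNat (M + 3) (r + 1) with hc
    set x : Fin (M + 3) := Fin.ofNat (M + 3) (r + 1 + u) with hx
    have hlab : ∀ v : ℕ, Fin.ofNat (M + 3) (r + 1 + v) = c + Fin.ofNat (M + 3) v := fun v => by
      rw [hc, ofNat_add']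
    have hsym : ∀ v ∈ range (M + 3), (if u < v then A x (Fin.ofNat (M + 3) (r + 1 + v))
        else if v < u then A (Fin.ofNat (M + 3) (r + 1 + v)) x else 0) =
        if v = u then 0 else A x (Fin.ofNat (M + 3) (r + 1 + v)) := by
      intro v _
      by_cases h1 : u < v
      · rw [if_pos h1, if_neg (by omega)]
      · by_cases h2 : v < u
        · rw [if_neg h1, if_pos h2, if_neg (by omega), hA]
        · rw [if_neg h1, if_neg h2, if_pos (by omega)]
    rw [Finset.sum_congr rfl hsym,
      ← Fin.sum_univ_eq_sum_range (fun v => if v = u then 0 else A x (Fin.ofNat (M + 3) (r + 1 + v))) (M + 3)]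
    have hterm : ∀ v : Fin (M + 3), (if (v : ℕ) = u then 0 else A x (Fin.ofNat (M + 3) (r + 1 + v))) =
        if c + v = x then 0 else A x (c + v) := by
      intro v
      rw [hlab, ofNat_val']
      have hiff : (v : ℕ) = u ↔ c + v = x := by
        rw [hx, hlab u]
        constructor
        · intro h; rw [← h, ofNat_val']
        · intro h
          have h' := add_left_cancel h
          rw [h', Fin.val_ofNat, Nat.mod_eq_of_lt (by omega)]
      simp only [hiff]
    rw [Finset.sum_congr rfl fun v _ => hterm v, sum_fin_rotate (fun y => if y = x then 0 else A x y) c, hbal x]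
    congr 2
    rw [hx, show r + 1 + u = (r + 1 + (u - 1)) + 1 by omega, ofNat_add', show Fin.ofNat (M + 3) 1 = 1 from rfl,
      add_sub_cancel_right]

/-- **Gauge independence**: for every `r`, the gap constant term with the point `r` at infinity (finite points
`r+1, r+2, …`) equals the one with the point `0` at infinity (finite points `1, 2, …`). -/
theorem gaugeCT_eq_gauge_zero (A : Fin (M + 3) → Fin (M + 3) → ℕ) (B : Fin (M + 3) → ℕ) (hA : ∀ x y, A x y = A y x)
    (hbal : ∀ x : Fin (M + 3), (∑ y : Fin (M + 3), if y = x then 0 else A x y) = B (x - 1) + B x) (r : ℕ) :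
    coeff (gapVec M fun t => B (Fin.ofNat (M + 3) (r + 1 + t)))
        (endProd M fun i j => A (Fin.ofNat (M + 3) (r + 1 + i)) (Fin.ofNat (M + 3) (r + 1 + j))) =
      coeff (gapVec M fun t => B (Fin.ofNat (M + 3) (1 + t)))
        (endProd M fun i j => A (Fin.ofNat (M + 3) (1 + i)) (Fin.ofNat (M + 3) (1 + j))) := by
  induction r with
  | zero => simp only [Nat.zero_add]
  | succ r ih => rw [← ih, show r + 1 + 1 = r + 2 from rfl]; exact gaugeCT_succ A B hA hbal r

end GapRegime

end Summit.KontsevichZagierPeriods.Zeta5Search.Families.Cellular
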